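import Literature.RepresentationTheory.FiniteGroups.StableLatticeReductionHom
import Mathlib.Algebra.Module.ZMod
import Mathlib.Algebra.MonoidAlgebra.Module
import Mathlib.RepresentationTheory.Invariants
import HarnessLib

/-!
# `#((ℤ[Δ]/p) ⊗ M′)^Δ = #M′`: invariants of the regular permutation module mod `p` twisted by a
# `p`-torsion module

Topic `RepresentationTheory/FiniteGroups`; namespace `Literature.RepresentationTheory.FiniteGroups`
(sub-namespace `TensorCoordinates`).  THEOREMS ONLY (no definition, no named fact, no `sorry`, no
instance).

For a finite group `Δ`, a natural number `p` (a prime in the application) and a finite `ℤ[Δ]`-module `M′` killed by `p`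
(`σ : Representation ℤ Δ M′`), the diagonal invariants of `(ℤ[Δ]/pℤ[Δ]) ⊗_ℤ M′` (left regular
permutation module `Representation.ofMulAction ℤ Δ Δ` reduced mod `p`, tensored with `σ`) are in
bijection with `M′`: in the coordinates `x = ∑_g [g] ⊗ x_g` one has `x ∈ (·)^Δ ⟺ x_g = σ(g) x₁`.
**`natCard_invariants_regular_tprod`**: `Nat.card ((ℤ[Δ]/p ⊗ M′)^Δ) = Nat.card M′`
(`dim (𝔽_p[Δ] ⊗ M₀)^Δ = dim M₀`, the normalisation of the twisted invariant of
`InvariantsAdditivePrimeToP` / Milne ADT I §5).  Lane «TATE-EPC-TC» of cell `bsd-eis`, brick B8-alg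
(normalisation for (E)), routed by -w7 g9.

## References
* [MilneADT2006] J. S. Milne, *Arithmetic Duality Theorems*, I §5 (proof of Thm. 5.1:
  `[M][𝔽_p[Ḡ]] = dim(M)·[𝔽_p[Ḡ]]`, `θ([N]) = #N^Ḡ`).
* [SerreLinearRepresentations1977] J.-P. Serre, *Linear Representations of Finite Groups*, §3.3
  (induced representations; `ℤ[G] ⊗ V`).
-/

namespace Literature.RepresentationTheory.FiniteGroups

namespace TensorCoordinates

open Function Submodule MonoidAlgebra StableLatticeReduction
open _root_.Representation _root_.LinearMap
open scoped Pointwise TensorProduct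

variable {Δ : Type} [Group Δ] [Fintype Δ] [DecidableEq Δ] {p : ℕ}

/-- **`#((ℤ[Δ]/p) ⊗_ℤ M′)^Δ = #M′`** for a finite `ℤ[Δ]`-module `M′` killed by `p` (diagonal action of
the left regular permutation module mod `p` and `σ`): the invariants are the `∑_g [g] ⊗ σ(g) m`.
[cite: MilneADT2006, I §5 (proof of Thm. 5.1)] [cite: SerreLinearRepresentations1977, §3.3] -/
theorem natCard_invariants_regular_tprod {M' : Type} [AddCommGroup M'] [Finite M']
    (σ : Representation ℤ Δ M') (hM : ∀ m : M', (p : ℤ) • m = 0) :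
    Nat.card (Representation.invariants ((((Representation.ofMulAction ℤ Δ Δ).quotient ((p : ℤ) • ⊤)
        (smul_top_le_comap _ (p : ℤ)))).tprod σ)) = Nat.card M' := by
  classical
  -- notation
  let W : Submodule ℤ (MonoidAlgebra ℤ Δ) := (p : ℤ) • ⊤
  let ρP := Representation.ofMulAction ℤ Δ Δ
  let ρQ := ρP.quotient W (smul_top_le_comap _ (p : ℤ))
  letI : Module (ZMod p) M' := AddCommGroup.zmodModule (fun m => by rw [← natCast_zsmul]; exact hM m)
  have hzs : ∀ (c : ZMod p) (m : M'), c • m = ((ZMod.cast c : ℤ)) • m := fun c m => by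
    rw [← Int.cast_smul_eq_zsmul (ZMod p), ZMod.intCast_zmod_cast]
  -- coefficients mod `p`: `cz g : Λ/W → ZMod p`
  let cg : Δ → (MonoidAlgebra ℤ Δ →ₗ[ℤ] ℤ) := fun g =>
    (Finsupp.lapply g) ∘ₗ (MonoidAlgebra.coeffLinearEquiv (S := ℤ) ℤ).toLinearMap
  have hcg : ∀ g f, cg g f = f.coeff g := fun g f => rfl
  let cz : Δ → (MonoidAlgebra ℤ Δ ⧸ W →ₗ[ℤ] ZMod p) := fun g =>
    W.liftQ ((Int.castAddHom (ZMod p)).toIntLinearMap ∘ₗ cg g) (by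
      intro f hf
      obtain ⟨f', rfl⟩ := (Int.mem_smul_top_iff _ _).1 hf
      rw [LinearMap.mem_ker, LinearMap.comp_apply, map_smul, AddMonoidHom.coe_toIntLinearMap,
        Int.coe_castAddHom]
      simp)
  have hcz : ∀ g f, cz g (Submodule.Quotient.mk f) = ((cg g f : ℤ) : ZMod p) := fun g f => rfl
  -- the basis vectors `[g]`
  let bq : Δ → MonoidAlgebra ℤ Δ ⧸ W := fun g => Submodule.Quotient.mk (MonoidAlgebra.single g 1)
  have hczb : ∀ g g', cz g (bq g') = if g' = g then 1 else 0 := fun g g' => by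
    rw [hcz, hcg, MonoidAlgebra.coeff_single, Finsupp.single_apply]
    by_cases h : g' = g
    · simp only [if_pos h, Int.cast_one]
    · simp only [if_neg h, Int.cast_zero]
  -- Φ and Ψ
  let Φ : (Δ → M') →ₗ[ℤ] (MonoidAlgebra ℤ Δ ⧸ W) ⊗[ℤ] M' :=
    ∑ g, (TensorProduct.mk ℤ _ M' (bq g)) ∘ₗ LinearMap.proj g
  have hΦ : ∀ h, Φ h = ∑ g, bq g ⊗ₜ[ℤ] h g := fun h => by simp [Φ]
  let B : (MonoidAlgebra ℤ Δ ⧸ W) →ₗ[ℤ] M' →ₗ[ℤ] (Δ → M') :=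
    LinearMap.mk₂ ℤ (fun q m => fun g => (cz g q) • m)
      (fun q q' m => by ext g; simp only [Pi.add_apply, map_add, add_smul])
      (fun k q m => by
        ext g
        simp only [Pi.smul_apply, map_smul]
        rw [zsmul_eq_mul, mul_smul, Int.cast_smul_eq_zsmul])
      (fun q m m' => by ext g; simp only [Pi.add_apply, smul_add])
      (fun k q m => by ext g; simp only [Pi.smul_apply]; rw [hzs, hzs, smul_comm])
  have hB : ∀ q m g, TensorProduct.lift B (q ⊗ₜ m) g = (cz g q) • m := fun q m g => by
    rw [TensorProduct.lift.tmul]; rfl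
  -- Ψ ∘ Φ = id
  have hΨΦ : ∀ h, TensorProduct.lift B (Φ h) = h := fun h => by
    rw [hΦ, map_sum (TensorProduct.lift B)]
    funext g
    rw [Finset.sum_apply]
    simp_rw [hB, hczb]
    rw [Finset.sum_eq_single g (fun g' _ hg' => by rw [if_neg hg', zero_smul]) (by simp), if_pos rfl,
      one_smul]
  -- Φ ∘ Ψ = id
  have hΛ : ∀ f : MonoidAlgebra ℤ Δ, (Submodule.Quotient.mk f : MonoidAlgebra ℤ Δ ⧸ W) =
      ∑ g, (cg g f) • bq g := by
    intro f
    induction f using MonoidAlgebra.induction_linear with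
    | zero => simp_rw [map_zero, zero_smul, Finset.sum_const_zero, Submodule.Quotient.mk_zero]
    | add f f' hf hf' =>
      rw [Submodule.Quotient.mk_add, hf, hf', ← Finset.sum_add_distrib]
      exact Finset.sum_congr rfl fun g _ => by rw [map_add, add_smul]
    | single a k =>
      simp_rw [hcg, MonoidAlgebra.coeff_single, Finsupp.single_apply]
      rw [Finset.sum_eq_single a (fun g _ hg => by simp only [if_neg (Ne.symm hg), zero_smul])
        (fun h => absurd (Finset.mem_univ a) h)]
      simp only [↓reduceIte]
      have hk : k • MonoidAlgebra.single a (1 : ℤ) = MonoidAlgebra.single a k := by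
        apply MonoidAlgebra.coeff_injective
        ext x
        rw [MonoidAlgebra.coeff_smul, Finsupp.smul_apply, MonoidAlgebra.coeff_single,
          MonoidAlgebra.coeff_single, Finsupp.single_apply, Finsupp.single_apply, smul_eq_mul, mul_ite,
          mul_one, mul_zero]
      change _ = Submodule.Quotient.mk (k • MonoidAlgebra.single a (1 : ℤ))
      rw [hk]
  have hΦΨ : ∀ t, Φ (TensorProduct.lift B t) = t := fun t => by
    induction t using TensorProduct.induction_on with
    | zero => rw [map_zero, map_zero]
    | tmul q m =>
      obtain ⟨f, rfl⟩ := mkQ_surjective _ q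
      have h1 : ∀ (k : ℤ) (g : Δ), (k • bq g) ⊗ₜ[ℤ] m = k • (bq g ⊗ₜ[ℤ] m) := fun k g =>
        ((TensorProduct.mk ℤ (MonoidAlgebra ℤ Δ ⧸ W) M').flip m).map_smul k (bq g)
      have h2 : ∀ (k : ℤ) (g : Δ), bq g ⊗ₜ[ℤ] (k • m) = k • (bq g ⊗ₜ[ℤ] m) := fun k g =>
        (TensorProduct.mk ℤ (MonoidAlgebra ℤ Δ ⧸ W) M' (bq g)).map_smul k m
      rw [hΦ]
      have hterm : ∀ g, bq g ⊗ₜ[ℤ] (cz g (Submodule.Quotient.mk f) • m) = ((cg g f) • bq g) ⊗ₜ[ℤ] m := by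
        intro g
        rw [hcz, Int.cast_smul_eq_zsmul, h2, ← h1]
      simp_rw [mkQ_apply, hB, hterm, ← TensorProduct.sum_tmul, ← hΛ f]
    | add a b ha hb => rw [map_add, map_add, ha, hb]
  -- the coordinate isomorphism and the action in coordinates
  let E : (Δ → M') ≃ₗ[ℤ] (MonoidAlgebra ℤ Δ ⧸ W) ⊗[ℤ] M' :=
    LinearEquiv.ofLinear Φ (TensorProduct.lift B) (LinearMap.ext hΦΨ) (LinearMap.ext hΨΦ)
  have hbq : ∀ c g, ρQ c (bq g) = bq (c * g) := fun c g => by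
    change Submodule.Quotient.mk (ρP c (MonoidAlgebra.single g 1)) = _
    rw [Representation.ofMulAction_single, smul_eq_mul]
  have hE : ∀ (c : Δ) (h : Δ → M'), E (fun g => σ c (h (c⁻¹ * g))) = (ρQ.tprod σ) c (E h) := by
    intro c h
    have hL : ∀ L : (MonoidAlgebra ℤ Δ ⧸ W) ⊗[ℤ] M' →ₗ[ℤ] (MonoidAlgebra ℤ Δ ⧸ W) ⊗[ℤ] M',
        L (∑ g, bq g ⊗ₜ[ℤ] h g) = ∑ g, L (bq g ⊗ₜ[ℤ] h g) := fun L => map_sum L _ _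
    change Φ _ = (ρQ.tprod σ) c (Φ h)
    rw [hΦ, hΦ]
    refine Eq.trans ?_ (hL ((ρQ.tprod σ) c)).symm
    -- `(ρQ ⊗ σ) c (q ⊗ m) = ρQ c q ⊗ σ c m` definitionally
    change _ = ∑ g, (ρQ c (bq g)) ⊗ₜ[ℤ] (σ c (h g))
    simp only [hbq]
    exact Fintype.sum_equiv (Equiv.mulLeft c⁻¹) _ _ fun x => by
      simp only [Equiv.coe_mulLeft, mul_inv_cancel_left]
  -- fixed points in coordinates ≃ invariants ≃ M'
  have hfix : Nat.card {h : Δ → M' // ∀ c, (fun g => σ c (h (c⁻¹ * g))) = h} =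
      Nat.card (Representation.invariants (ρQ.tprod σ)) := by
    refine Nat.card_congr (E.toEquiv.subtypeEquiv fun h => ?_)
    change (∀ c, (fun g => σ c (h (c⁻¹ * g))) = h) ↔ ∀ c : Δ, (ρQ.tprod σ) c (E h) = E h
    refine forall_congr' fun c => ?_
    rw [← hE]
    exact ⟨fun hh => by rw [hh], fun hh => E.injective hh⟩
  rw [← hfix]
  refine Nat.card_congr
    { toFun := fun h => h.1 1
      invFun := fun m => ⟨fun g => σ g m, fun c => funext fun g => by
        change σ c (σ (c⁻¹ * g) m) = σ g m
        rw [← Module.End.mul_apply, ← map_mul, mul_inv_cancel_left]⟩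
      left_inv := fun h => Subtype.ext (funext fun g => by
        have := congrFun (h.2 g) g
        change σ g (h.1 (g⁻¹ * g)) = h.1 g at this
        rw [inv_mul_cancel] at this
        exact this)
      right_inv := fun m => by change σ 1 m = m; rw [map_one]; rfl }

end TensorCoordinates

end Literature.RepresentationTheory.FiniteGroups
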